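import Summits.QuantumAdvantage.QuantumAdvantage.Theorems.FlatDialReadout

/-!
# FlatDialCircuit — module 2/3 of the FlatDial THEOREMS package (cell decomp-qadv, lens-3 generation 11)

§4 THE TABLE ALPHABET: instances of the signed exact cubic slice as bit vectors (`TabIdx`, `pairOf`, `tabOf`, `pairOf_tabOf`), table-level
`AC⁰[⊕]` families (`realisable`, `realisableOut` — Vollmer gate lists `ACRealOver (accBasis 2)`, constant depth, size polynomial in the
arity), the solver set `signers`, and ★ `signedSlice_not_mem_promiseLift_of_no_signer` (no table-level signer ⟹ the statement of
item 27991, via the literal projection `isProj_encode_pairOf` and `acRealOver_circuit_comp`).  §5 THE READOUT IS ONE LAYER: ★ `realisable_rho`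
— over any realisable certificate map the flat readout `w ↦ ρ(pairOf w, c w)` is realisable (depth `+5`, size `rhoPoly`).

Provenance: farm-checked node file `FlatDial.lean` (HOME/decomp-qadv-lens-3/g11/; rc 0 · 0 sorry · axioms ⊆ {propext, Classical.choice,
Quot.sound}); record HOME/decomp-qadv-lens-3/g11/NODE-g11.md.  Modules: FlatDialReadout → FlatDialCircuit → FlatDialSearch (each imports its
predecessor).  Namespace `Summit.QuantumAdvantage.QuantumAdvantage.Theorems.FlatDial`.  Uses the landed HintDial package BY NAME (`HintDial.bit*`, `isDualOf_of_forrelation_eq_one`,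
`HintDial.Automaton.bd`, `HintDial.Automaton.IsLit/IsProj/evalLit/lenB`, `acRealOver_evalLit`) ; nothing of it is restated.  ZERO `def … : Prop`:
every predicate is a `Set` with an `Iff.rfl` membership lemma (`halfSpaces`, `affineSlopes`, `weaklyNormal`, `validCerts`, `hasFlatCert`,
`realisable`, `realisableOut`, `signers`, `flatReaders`, `pairFinders`, `realisableOutG`, `signedCubicDuals`, `finders`), and the node's pieces
`T_tab`, `T'`, `N`, `W`, `L`, `A_W` are spelled INLINE in the theorems (a route file defines the items as one-liners over these sets).
-/

set_option linter.dupNamespace false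

noncomputable section

namespace Summit.QuantumAdvantage.QuantumAdvantage.Theorems.FlatDial

open Finset
open Literature.Computability.Complexity
open Literature.Computability.QuantumComplexity
open Literature.Computability.MetaComplexity
open _root_.Computability (encodeNat)
open Literature.Computability.QuantumComplexity.BuzetChailloux (bxor zeroVec bxor_self bxor_bxor_cancel_left
  twist_bxor_right twist_zeroVec_right)
open Literature.Computability.QuantumComplexity.Simon (twist_eq_one_or twist_mul_self)
open Literature.Computability.QuantumComplexity.DerivativeWalsh (W twist_bxor_left card_mul_sum_coset
  perp_perp_eq_of_sq all_eq_of_sum_eq_card)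
open Summit.QuantumAdvantage.QuantumAdvantage.Theorems.HintDial (IsDualOf isDualOf_of_forrelation_eq_one
  forrelation_eq_one_of_isDualOf bit_xor bit_and bit_not bit_eq_ite bit_injective bit_decide_odd eval_bit)
open Literature.Computability.QuantumComplexity.CubicForm (bit)
open Summit.QuantumAdvantage.QuantumAdvantage.Theorems.HintDial.Automaton

/-! ## §4 THE TABLE ALPHABET: instances as bit vectors, table-level `AC⁰[⊕]` families, and the reading `T_tab` of `T` -/

section Tables

/-- Index of the coefficient tables of an arity-`n` pair: (which form, `none` = constant bit | `some (i,j,l)` = cube entry). -/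
abbrev TabIdx (n : ℕ) : Type := Bool × Option (Fin n × Fin n × Fin n)

/-- Number of table bits of an arity-`n` pair (`= 2(n³+1)`). -/
def tabN (n : ℕ) : ℕ := Fintype.card (TabIdx n)

/-- A fixed enumeration of the table positions. -/
def tabEquiv (n : ℕ) : TabIdx n ≃ Fin (tabN n) := Fintype.equivFin (TabIdx n)

/-- The form on side `b` (`false = F`, `true = G`) read from a table vector. -/
def formOf (n : ℕ) (b : Bool) (w : Fin (tabN n) → Bool) : CubicForm n :=
  ⟨w (tabEquiv n (b, none)), fun i j l => w (tabEquiv n (b, some (i, j, l)))⟩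

/-- ★ The instance presented by a table vector. -/
def pairOf (n : ℕ) (w : Fin (tabN n) → Bool) : CubicANFPair := ⟨n, formOf n false w, formOf n true w⟩

/-- The table vector of an instance. -/
def tabOf (I : CubicANFPair) : Fin (tabN I.n) → Bool := fun k =>
  match (tabEquiv I.n).symm k with
  | (false, none) => I.F.const
  | (false, some (i, j, l)) => I.F.cube i j l
  | (true, none) => I.G.const
  | (true, some (i, j, l)) => I.G.cube i j l

/-- The arity of the presented instance. -/
@[simp] theorem pairOf_n (n : ℕ) (w : Fin (tabN n) → Bool) : (pairOf n w).n = n := rfl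

/-- Every instance is presented by its table vector (the table alphabet loses nothing). -/
theorem pairOf_tabOf (I : CubicANFPair) : pairOf I.n (tabOf I) = I := by
  obtain ⟨n, ⟨cF, tF⟩, ⟨cG, tG⟩⟩ := I
  simp [pairOf, formOf, tabOf, Equiv.symm_apply_apply]

/-- ★ THE TABLE-LEVEL `AC⁰[⊕]` FAMILIES of Boolean functions: one function of the table bits per arity, realised over `{¬,∧,∨,MOD₂}` in
constant depth and size polynomial IN THE ARITY (Vollmer's gate-list semantics `ACRealOver`, the tree's circuit model). [cite: Vollmer1999, §1.2] -/
def realisable : Set ((n : ℕ) → (Fin (tabN n) → Bool) → Bool) :=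
  {D | ∃ d : ℕ, ∃ r : Polynomial ℕ, ∀ n, ACRealOver (accBasis 2) (D n) d (r.eval n)}

/-- Membership in `realisable` unfolded. -/
theorem mem_realisable {D : (n : ℕ) → (Fin (tabN n) → Bool) → Bool} :
    D ∈ realisable ↔ ∃ d : ℕ, ∃ r : Polynomial ℕ, ∀ n, ACRealOver (accBasis 2) (D n) d (r.eval n) := Iff.rfl

/-- THE table-level `AC⁰[⊕]` families of MULTI-OUTPUT functions (output alphabet `κ n`): every output bit realised within one depth and
one polynomial size bound. [cite: Vollmer1999, §1.2] -/
def realisableOut (κ : ℕ → Type) : Set ((n : ℕ) → (Fin (tabN n) → Bool) → κ n → Bool) :=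
  {E | ∃ d : ℕ, ∃ r : Polynomial ℕ, ∀ n k, ACRealOver (accBasis 2) (fun w => E n w k) d (r.eval n)}

/-- Membership in `realisableOut` unfolded. -/
theorem mem_realisableOut {κ : ℕ → Type} {E : (n : ℕ) → (Fin (tabN n) → Bool) → κ n → Bool} :
    E ∈ realisableOut κ ↔ ∃ d : ℕ, ∃ r : Polynomial ℕ, ∀ n k, ACRealOver (accBasis 2) (fun w => E n w k) d (r.eval n) := Iff.rfl

/-- ★ THE SIGNERS: families `D` that, on every exact cubic pair of even arity presented by its coefficient tables, output the sign
bit (`true` on `Φ = +1`, `false` on `Φ = -1`).  The node's `T_tab` is `¬ ∃ D ∈ realisable, D ∈ signers`. [cite: AaronsonAmbainis2018, §1.1.1] -/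
def signers : Set ((n : ℕ) → (Fin (tabN n) → Bool) → Bool) :=
  {D | ∀ (n : ℕ) (w : Fin (tabN n) → Bool), Even n →
    ((pairOf n w).value = 1 → D n w = true) ∧ ((pairOf n w).value = -1 → D n w = false)}

/-- Membership in `signers` unfolded. -/
theorem mem_signers {D : (n : ℕ) → (Fin (tabN n) → Bool) → Bool} : D ∈ signers ↔
    ∀ (n : ℕ) (w : Fin (tabN n) → Bool), Even n →
      ((pairOf n w).value = 1 → D n w = true) ∧ ((pairOf n w).value = -1 → D n w = false) := Iff.rfl

/-- `encode` of a form whose coefficients are literals is a literal projection (variant of `HintDial.Automaton.isProj_encode_form` with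
a literal — not constant — constant coefficient). -/
theorem isProj_encode_form' {m N : ℕ} (Φ : (Fin m → Bool) → CubicForm N) (hc : IsLit fun w => (Φ w).const)
    (hcube : ∀ i j l, IsLit fun w => (Φ w).cube i j l) : IsProj fun w => (Φ w).encode := by
  unfold CubicForm.encode
  exact (IsProj.single hc).boolPair (IsProj.encodeCodeList
    (fun i w => encodeCodeList (List.ofFn fun j => List.ofFn fun l => (Φ w).cube i j l))
    fun i => IsProj.encodeCodeList (fun j w => List.ofFn fun l => (Φ w).cube i j l)
      fun j => IsProj.ofFn (fun l w => (Φ w).cube i j l) fun l => IsProj.single (hcube i j l))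

/-- ★ The instance code is a LITERAL PROJECTION of the table bits. -/
theorem isProj_encode_pairOf (n : ℕ) : IsProj fun w : Fin (tabN n) → Bool => (pairOf n w).encode := by
  unfold CubicANFPair.encode pairOf
  exact (IsProj.const (encodeNat n)).boolPair
    ((isProj_encode_form' (fun w => formOf n false w) (isLit_input _) fun i j l => isLit_input _).boolPair
      (isProj_encode_form' (fun w => formOf n true w) (isLit_input _) fun i j l => isLit_input _))

/-- The code-length polynomial `12n³ + 12n² + 8n + 16` (`= HintDial.Automaton.lenB n`). -/
def lenPoly : Polynomial ℕ :=
  Polynomial.C 12 * Polynomial.X ^ 3 + Polynomial.C 12 * Polynomial.X ^ 2 + Polynomial.C 8 * Polynomial.X + Polynomial.C 16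

/-- `lenPoly` evaluates to `lenB`. -/
theorem lenPoly_eval (n : ℕ) : lenPoly.eval n = lenB n := by simp [lenPoly, lenB]

/-- Transport of a circuit family along an equality of input lengths. -/
theorem eval_family_cast (C : CircuitFamily) {N M : ℕ} (h : N = M) (v : Fin M → Bool) :
    (C N).eval (fun j => v (Fin.cast h j)) = (C M).eval v := by subst h; rfl

/-- ★ `T_tab → T` (the statement of item 27991 `AnfPresentation.RungANonuniform`, verbatim over Literature): a string-level `AC⁰[⊕]`
family signing the codes, composed with the literal projection `tables ↦ code` (Vollmer composition `acRealOver_circuit_comp`, depth `+1`),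
is a table-level family signing the pairs; so NO table-level signer ⟹ the signed exact cubic slice is not in promise-`AC⁰[⊕]`. -/
theorem signedSlice_not_mem_promiseLift_of_no_signer
    (hT : ¬ ∃ D : (n : ℕ) → (Fin (tabN n) → Bool) → Bool, D ∈ realisable ∧ D ∈ signers) :
    SignedExactCubicSliceANF ∉ promiseLift (AC0Mod 2) := by
  rintro ⟨L, ⟨d, r, C, hC, hDec⟩, hyes, hno⟩
  apply hT
  choose S hS using fun n => isProj_encode_pairOf n
  refine ⟨fun n w => (C (S n).length).eval fun j => evalLit w ((S n).get j),
    mem_realisable.2 ⟨d + 1, r.comp lenPoly + lenPoly, fun n => ?_⟩,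
    fun n w hn => ?_⟩
  · have h := acRealOver_circuit_comp (C (S n).length) (hC _).1 (fun j => acRealOver_evalLit 2 ((S n).get j))
    have hlen : (S n).length ≤ lenPoly.eval n := by
      have e := hS n fun _ => false
      rw [lenPoly_eval]
      calc (S n).length = ((S n).map (evalLit fun _ => false)).length := (List.length_map _).symm
        _ = (pairOf n fun _ => false).encode.length := by rw [← e]
        _ ≤ lenB n := length_encode_pair_le _
    refine h.mono ?_ ?_
    · exact Nat.add_le_add_right (hC _).2.1 1
    · rw [Polynomial.eval_add, Polynomial.eval_comp]
      refine Nat.add_le_add ((hC _).2.2.trans (natPoly_eval_mono r hlen)) ?_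
      simpa using hlen
  · -- correctness: the composed function is the string family's answer on the code
    set v : Fin (S n).length → Bool := fun j => evalLit w ((S n).get j) with hv
    have hcode : List.ofFn v = (pairOf n w).encode := by rw [hv, ofFn_evalLit, ← hS]
    have hev : (C (S n).length).eval v = L.boolIndicator (pairOf n w).encode := by
      rw [← hcode, ← hDec (List.ofFn v), ← eval_family_cast C (List.length_ofFn (f := v)).symm]
      congr 1; funext j; rw [List.get_ofFn]; rfl
    refine ⟨fun h1 => ?_, fun h1 => ?_⟩
    · show (C (S n).length).eval v = true
      rw [hev]; exact (Set.mem_iff_boolIndicator _ _).1 (hyes ((CubicANFPair.encode_mem_yes_iff _).2 ⟨hn, h1⟩))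
    · show (C (S n).length).eval v = false
      rw [hev]; exact (Set.notMem_iff_boolIndicator _ _).1 (hno ((CubicANFPair.encode_mem_no_iff _).2 ⟨hn, h1⟩))

end Tables

/-! ## §5 THE READOUT IS ONE `AC⁰[⊕]` LAYER: constant-depth realisation of `w ↦ ρ(pairOf w, c(w))` over any certificate map `c` (kernel) -/

section ReadoutCircuit

variable {ι : Type}

/-- Binary AND of two realised functions (one `∧₂` gate). -/
theorem acRealOver_and2 {f g : (ι → Bool) → Bool} {d s : ℕ} (hf : ACRealOver (accBasis 2) f d s)
    (hg : ACRealOver (accBasis 2) g d s) : ACRealOver (accBasis 2) (fun x => f x && g x) (d + 1) (2 * s + 1) := by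
  have h := acRealOver_forall_const (acBasis_subset_accBasis 2) (f := ![f, g]) (d := d) (s := s)
    (fun j => by fin_cases j; exacts [hf, hg])
  exact h.congr fun x => by simp [Fin.forall_fin_two]

/-- One `MOD₂` gate computes the parity of realised functions. -/
theorem acRealOver_parity {M d s : ℕ} {f : Fin M → (ι → Bool) → Bool} (h : ∀ k, ACRealOver (accBasis 2) (f k) d s) :
    ACRealOver (accBasis 2) (fun x => decide (Odd (GateFn.numOnes fun k => f k x))) (d + 1) (M * s + 1) := by
  have hmem : GateFn.modGate 2 M ∈ accBasis 2 := Set.mem_union_right _ (Set.mem_iUnion.2 ⟨M, rfl⟩)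
  have hg := acRealOver_gate (GateFn.modGate 2 M) hmem (f := f) (d := d) (s := fun _ => s) h
  have hsz : (∑ _j : Fin (GateFn.modGate 2 M).1, s) + 1 ≤ M * s + 1 := by
    simp only [Finset.sum_const, Finset.card_univ, Fintype.card_fin, smul_eq_mul]; exact le_rfl
  refine (hg.mono le_rfl hsz).congr fun x => ?_
  show decide (GateFn.numOnes (fun k => f k x) % 2 ≠ 0) = _
  simp [Nat.odd_iff]

/-- The bit of a parity is the sum of the bits. -/
theorem bit_parity {M : ℕ} (v : Fin M → Bool) : bit (decide (Odd (GateFn.numOnes v))) = ∑ k, bit (v k) := by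
  rw [bit_decide_odd, GateFn.numOnes, Finset.natCast_card_filter]
  exact sum_congr rfl fun k _ => (bit_eq_ite (v k)).symm

variable (n : ℕ)

/-- Number of coefficient bits of one cubic form of arity `n` (`= n³ + 1`). -/
def formN : ℕ := Fintype.card (Option (Fin n × Fin n × Fin n))

/-- A fixed enumeration of the coefficient positions of one form. -/
def formEquiv : Option (Fin n × Fin n × Fin n) ≃ Fin (formN n) := Fintype.equivFin _

/-- A one-form table has `n³ + 1` bits. -/
theorem formN_eq : formN n = n ^ 3 + 1 := by
  simp [formN, Fintype.card_option, Fintype.card_prod, Fintype.card_fin]; ring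

/-- The term `cube_{ijl} · p_i · p_j · p_l` of side `b` at the point `p(w)`. -/
def cubeTerm (b : Bool) (p : (Fin (tabN n) → Bool) → Fin n → Bool) (q : Fin n × Fin n × Fin n)
    (w : Fin (tabN n) → Bool) : Bool :=
  ((w (tabEquiv n (b, some q)) && p w q.1) && p w q.2.1) && p w q.2.2

/-- The terms of `(form b)(p(w))`: the constant bit and the cube terms. -/
def formTerm (b : Bool) (p : (Fin (tabN n) → Bool) → Fin n → Bool) :
    Option (Fin n × Fin n × Fin n) → (Fin (tabN n) → Bool) → Bool
  | none => fun w => w (tabEquiv n (b, none))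
  | some q => cubeTerm n b p q

/-- `(form b)(p(w))` as ONE parity of the terms. -/
def formPar (b : Bool) (p : (Fin (tabN n) → Bool) → Fin n → Bool) (w : Fin (tabN n) → Bool) : Bool :=
  decide (Odd (GateFn.numOnes fun k : Fin (formN n) => formTerm n b p ((formEquiv n).symm k) w))

variable {n}

/-- Realisation of one cube monomial of the table form at a realisable point. -/
theorem acRealOver_cubeTerm {b : Bool} {p : (Fin (tabN n) → Bool) → Fin n → Bool} {d s : ℕ}
    (hp : ∀ i, ACRealOver (accBasis 2) (fun w => p w i) d s) (q : Fin n × Fin n × Fin n) :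
    ACRealOver (accBasis 2) (cubeTerm n b p q) (d + 3) (8 * s + 7) := by
  have h0 : ACRealOver (accBasis 2) (fun w : Fin (tabN n) → Bool => w (tabEquiv n (b, some q))) d s :=
    (acRealOver_input _ _).mono (Nat.zero_le _) (Nat.zero_le _)
  have h1 := acRealOver_and2 h0 (hp q.1)
  have h2 := acRealOver_and2 h1 ((hp q.2.1).mono (Nat.le_succ _) (by omega))
  have h3 := acRealOver_and2 h2 ((hp q.2.2).mono (by omega) (by omega))
  exact h3.mono le_rfl (by omega)

/-- Realisation of one ANF term of the table form at a realisable point. -/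
theorem acRealOver_formTerm {b : Bool} {p : (Fin (tabN n) → Bool) → Fin n → Bool} {d s : ℕ}
    (hp : ∀ i, ACRealOver (accBasis 2) (fun w => p w i) d s) (o : Option (Fin n × Fin n × Fin n)) :
    ACRealOver (accBasis 2) (formTerm n b p o) (d + 3) (8 * s + 7) := by
  cases o with
  | none => exact (acRealOver_input _ _).mono (Nat.zero_le _) (Nat.zero_le _)
  | some q => exact acRealOver_cubeTerm hp q

/-- ★ Evaluating one side of the instance at a realised point costs TWO more layers (`∧` then `MOD₂`). -/
theorem acRealOver_formPar {b : Bool} {p : (Fin (tabN n) → Bool) → Fin n → Bool} {d s : ℕ}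
    (hp : ∀ i, ACRealOver (accBasis 2) (fun w => p w i) d s) :
    ACRealOver (accBasis 2) (formPar n b p) (d + 4) ((n ^ 3 + 1) * (8 * s + 7) + 1) := by
  have h := acRealOver_parity fun k => acRealOver_formTerm hp ((formEquiv n).symm k) (b := b)
  refine h.mono le_rfl (le_of_eq ?_)
  rw [formN_eq]

/-- The table form at a point is the parity of its ANF terms. -/
theorem formPar_eq (b : Bool) (p : (Fin (tabN n) → Bool) → Fin n → Bool) (w : Fin (tabN n) → Bool) :
    formPar n b p w = (formOf n b w).eval (p w) := by
  apply bit_injective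
  rw [formPar, bit_parity, eval_bit, Equiv.sum_comp (formEquiv n).symm (fun o => bit (formTerm n b p o w)),
    Fintype.sum_option]
  simp only [formTerm, cubeTerm, formOf, bit_and]
  simp_rw [Fintype.sum_prod_type]
  refine congrArg₂ (· + ·) rfl (Fintype.sum_congr _ _ fun i => Fintype.sum_congr _ _ fun j =>
    Fintype.sum_congr _ _ fun l => by ring)

/-- `⟨p(w), p'(w)⟩` as one parity of binary ANDs. -/
def bdPar (n : ℕ) (p p' : (Fin (tabN n) → Bool) → Fin n → Bool) (w : Fin (tabN n) → Bool) : Bool :=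
  decide (Odd (GateFn.numOnes fun i : Fin n => p w i && p' w i))

/-- Realisation of the inner product of two realisable points. -/
theorem acRealOver_bdPar {p p' : (Fin (tabN n) → Bool) → Fin n → Bool} {d s : ℕ}
    (hp : ∀ i, ACRealOver (accBasis 2) (fun w => p w i) d s) (hp' : ∀ i, ACRealOver (accBasis 2) (fun w => p' w i) d s) :
    ACRealOver (accBasis 2) (bdPar n p p') (d + 2) (n * (2 * s + 1) + 1) :=
  acRealOver_parity fun i => acRealOver_and2 (hp i) (hp' i)

/-- The inner product is the parity of coordinate products. -/
theorem bdPar_eq (p p' : (Fin (tabN n) → Bool) → Fin n → Bool) (w : Fin (tabN n) → Bool) :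
    bdPar n p p' w = bd (p w) (p' w) := by
  apply bit_injective
  rw [bdPar, bit_parity, bit_bd]
  simp only [bit_and]

/-- The size polynomial of the readout layer over certificates of size `r`. -/
def rhoPoly (r : Polynomial ℕ) : Polynomial ℕ :=
  3 * ((Polynomial.X ^ 3 + 1) * (8 * r + 7) + 1) + 1

/-- Evaluation of the readout size polynomial. -/
theorem rhoPoly_eval (r : Polynomial ℕ) (n : ℕ) : (rhoPoly r).eval n = 3 * ((n ^ 3 + 1) * (8 * r.eval n + 7) + 1) + 1 := by
  simp [rhoPoly]

/-- ★★ THE READOUT LAYER.  For ANY table-level `AC⁰[⊕]` certificate map `c` (each output bit realised in depth `d`, size `r(n)`),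
the readout `w ↦ ρ(pairOf w, c(w))` is a table-level `AC⁰[⊕]` family (depth `d + 5`, size `rhoPoly r`).  So the sign problem is
EXACTLY AS HARD AS FINDING A FLAT, up to five layers. -/
theorem realisable_rho {c : (n : ℕ) → (Fin (tabN n) → Bool) → CertIdx n → Bool} (hc : c ∈ realisableOut CertIdx) :
    (fun n w => rho (pairOf n w) (c n w)) ∈ realisable := by
  obtain ⟨d, r, h⟩ := hc
  refine mem_realisable.2 ⟨d + 5, rhoPoly r, fun n => ?_⟩
  have hT : ∀ i, ACRealOver (accBasis 2) (fun w => certT (c n w) i) d (r.eval n) := fun i => h n (Sum.inl i)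
  have hX : ∀ i, ACRealOver (accBasis 2) (fun w => certXs (c n w) i) d (r.eval n) := fun i => h n (Sum.inr (Sum.inr i))
  set K := (n ^ 3 + 1) * (8 * r.eval n + 7) + 1 with hK
  have hA := acRealOver_formPar (b := true) hT
  have hB := acRealOver_formPar (b := false) hX
  have hnK : n * (2 * r.eval n + 1) + 1 ≤ K := by
    have h1 : n ≤ n ^ 3 + 1 := by
      rcases Nat.eq_zero_or_pos n with rfl | hn
      · simp
      · exact (Nat.le_self_pow (by norm_num) n).trans (Nat.le_succ _)
    have h2 : 2 * r.eval n + 1 ≤ 8 * r.eval n + 7 := by omega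
    exact Nat.add_le_add_right (Nat.mul_le_mul h1 h2) 1
  have hC := (acRealOver_bdPar hT hX).mono (show d + 2 ≤ d + 4 by omega) hnK
  have hpar := acRealOver_parity (f := ![formPar n true (fun w => certT (c n w)), formPar n false (fun w => certXs (c n w)),
      bdPar n (fun w => certT (c n w)) (fun w => certXs (c n w))]) (d := d + 4) (s := K)
    (fun j => by fin_cases j; exacts [hA, hB, hC])
  refine (hpar.mono le_rfl (by rw [rhoPoly_eval])).congr fun w => ?_
  apply bit_injective
  show bit (decide (Odd (GateFn.numOnes fun k => ![formPar n true (fun w => certT (c n w)),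
      formPar n false (fun w => certXs (c n w)), bdPar n (fun w => certT (c n w)) (fun w => certXs (c n w))] k w))) =
    bit (xor (xor ((pairOf n w).G.eval (certT (c n w))) ((pairOf n w).F.eval (certXs (c n w)))) (bd (certT (c n w)) (certXs (c n w))))
  rw [bit_parity, Fin.sum_univ_three, bit_xor, bit_xor]
  simp only [Matrix.cons_val_zero, Matrix.cons_val_one, Matrix.cons_val_two, Matrix.head_cons, Matrix.tail_cons,
    formPar_eq, bdPar_eq]
  rfl

/-- Negation is free. -/
theorem realisable_not {D : (n : ℕ) → (Fin (tabN n) → Bool) → Bool} (h : D ∈ realisable) :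
    (fun n w => !D n w) ∈ realisable := by
  obtain ⟨d, r, h⟩ := h
  exact mem_realisable.2 ⟨d, r + 1, fun n => by simpa using (h n).neg (Smolensky.not_mem_accBasis 2)⟩

end ReadoutCircuit

end Summit.QuantumAdvantage.QuantumAdvantage.Theorems.FlatDial

end
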